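import Literature.NumberTheory.GaloisRepresentations.LubinTateColemanRelativeTildeTwo
import HarnessLib

/-!
# `q = 2`, relative situation: twisted-`𝒩_E`-invariant series are closed under `(π, X)`-adic limits

De Shalit, *Iwasawa theory of elliptic curves with complex multiplication* (1987), Ch. I §3.12 Corollary (proof): the Coleman
power series with `𝒩g = g^φ` form a closed (compact) set, so limits of such series are again of this kind.  The tree's
`LubinTateColemanNormClosed` proves the absolute, untwisted statement by evaluating at division points.  THIS FILE gives a purely
ALGEBRAIC proof of the relative, twisted statement for `f = πX + X²` over `𝒪_E` (`E ⊇ F` finite, `|𝓀_F| = 2`, `ψ` a ring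
endomorphism of `𝒪_E` with `ψ(π) = π`), in the `(π, X)`-adic filtration `I_N = {V : coeff_k V ∈ (π^{N−k})}` (`adicFiltGen`):

* generic lemmas on `I_N` over any `S⟦X⟧` (`pow_sub_one_mem_adicFiltGen`, `sq_sub_one_mem_adicFiltGen`,
  `pow_two_pow_sub_one_mem_adicFiltGen`, `sub_one_mem_adicFiltGen_one`, `derivative_mem_adicFiltGen`,
  `mem_adicFiltGen_of_mem_coeffIdeal`, `coeff_mul_mem_of_forall_le`);
* ★ `coeff_mem_of_subst_mem_adicFiltGen` — **cancellation along `∘ f`** for `f = pX + X²` over a domain: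
  `D ∘ f ∈ I_M ⟹ coeff_k D ∈ (p^{M−2k})`;
* ★ `reflE_mem_adicFiltGen` — the reflection `τ_E : G ↦ G(−π−X)` preserves every `I_N`;
* ★★ `relNormTwo_eq_map_of_forall_sub_mem` — **if units `G_N` with `𝒩_E G_N = G_N^ψ` satisfy `G − G_N ∈ I_{N+1}` for all `N`,
  then `𝒩_E G = G^ψ`** (`𝒩_E(1+V) − 1 =: D` has `D∘f = V + τV + VτV ∈ I_{N+1}`, so `coeff_k D ∈ (π^{N+1−2k})`, and
  `𝒩_E G − G^ψ = G_N^ψ·(D − V^ψ)`).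

Everything PROVED (0 sorry).  Used by `LubinTateColemanRelativeLogDerivLimitTwo` (surjectivity of `δ_E`).

## References

* E. de Shalit, *Iwasawa theory of elliptic curves with complex multiplication* (1987), Ch. I §3.12 Corollary, §3.13. [deShalit1987]
-/

noncomputable section

open scoped PowerSeries.WithPiTopology

namespace Literature.NumberTheory.GaloisRepresentations

namespace LubinTate

section AdicFiltGenLemmas

variable {S : Type*} [CommRing S] {p : S}

/-- `coeffIdeal (p^j) ⊆ I_j`. [cite: deShalit1987, Ch. I §3.12 Corollary (proof)] -/
theorem mem_adicFiltGen_of_mem_coeffIdeal {j : ℕ} {V : PowerSeries S} (hV : V ∈ coeffIdeal (Ideal.span {p ^ j})) :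
    V ∈ adicFiltGen p j := fun k =>
  Ideal.mem_span_singleton.mpr (dvd_trans (pow_dvd_pow _ (by omega)) (Ideal.mem_span_singleton.mp (hV k)))

/-- `u − 1 ∈ I_j ⟹ u^r − 1 ∈ I_j`. [cite: deShalit1987, Ch. I §3.12 Corollary (proof)] -/
theorem pow_sub_one_mem_adicFiltGen {j : ℕ} {u : PowerSeries S} (hu : u - 1 ∈ adicFiltGen p j) (r : ℕ) :
    u ^ r - 1 ∈ adicFiltGen p j := by
  obtain ⟨c, hc⟩ := sub_dvd_pow_sub_pow u 1 r
  rw [one_pow] at hc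
  rw [hc]
  exact Ideal.mul_mem_right _ _ hu

/-- `X ∈ I_1`. [cite: deShalit1987, Ch. I §3.13 Lemma (proof)] -/
theorem X_mem_adicFiltGen_one : (PowerSeries.X : PowerSeries S) ∈ adicFiltGen p 1 :=
  mem_adicFiltGen_one_of_constantCoeff_eq_zero PowerSeries.constantCoeff_X

/-- `C p ∈ I_1`. [cite: deShalit1987, Ch. I §3.13 Lemma (proof)] -/
theorem C_self_mem_adicFiltGen_one : PowerSeries.C p ∈ adicFiltGen p 1 :=
  C_mem_adicFiltGen (by rw [pow_one]; exact Ideal.mem_span_singleton_self p)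

/-- `t ∈ I_j`, `j ≥ 1`, `2 ∈ (p)` ⟹ `(1 + t)² − 1 ∈ I_{j+1}`. [cite: deShalit1987, Ch. I §3.12 Corollary (proof)] -/
theorem sq_sub_one_mem_adicFiltGen (h2 : (2 : S) ∈ Ideal.span {p}) {j : ℕ} (hj : 1 ≤ j) {t : PowerSeries S}
    (ht : t ∈ adicFiltGen p j) : (1 + t) ^ 2 - 1 ∈ adicFiltGen p (j + 1) := by
  obtain ⟨u, hu⟩ := Ideal.mem_span_singleton'.mp h2
  have e : (1 + t) ^ 2 - 1 = PowerSeries.C p * (PowerSeries.C u * t) + t * t := by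
    rw [← mul_assoc, ← map_mul, mul_comm p u, hu, map_ofNat]; ring
  rw [e]
  refine add_mem ?_ (adicFiltGen_mono (by omega) (mul_mem_adicFiltGen ht ht))
  have := mul_mem_adicFiltGen (C_self_mem_adicFiltGen_one (p := p)) (Ideal.mul_mem_left _ (PowerSeries.C u) ht)
  rwa [add_comm] at this

/-- `g − 1 ∈ I_1`, `2 ∈ (p)` ⟹ `g^{2^N} − 1 ∈ I_{N+1}`. [cite: deShalit1987, Ch. I §3.12 Corollary (proof)] -/
theorem pow_two_pow_sub_one_mem_adicFiltGen (h2 : (2 : S) ∈ Ideal.span {p}) {g : PowerSeries S}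
    (hg : g - 1 ∈ adicFiltGen p 1) (N : ℕ) : g ^ 2 ^ N - 1 ∈ adicFiltGen p (N + 1) := by
  induction N with
  | zero => rwa [pow_zero, pow_one]
  | succ N ih =>
    have e : g ^ 2 ^ (N + 1) - 1 = (1 + (g ^ 2 ^ N - 1)) ^ 2 - 1 := by rw [pow_succ, pow_mul]; ring
    rw [e]
    exact sq_sub_one_mem_adicFiltGen h2 (by omega) ih

/-- A principal unit lies in `1 + I_1`. [cite: deShalit1987, Ch. I §3.12 Corollary (proof)] -/
theorem sub_one_mem_adicFiltGen_one {g : PowerSeries S} (hg : PowerSeries.constantCoeff g - 1 ∈ Ideal.span {p}) :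
    g - 1 ∈ adicFiltGen p 1 := by
  intro k
  rcases k with _ | k
  · rw [Nat.sub_zero, pow_one, map_sub, PowerSeries.coeff_zero_eq_constantCoeff, map_one]; exact hg
  · rw [show 1 - (k + 1) = 0 by omega, pow_zero, Ideal.span_singleton_one]; exact Submodule.mem_top

/-- `t ∈ I_j ⟹ t' ∈ I_{j−1}`. [cite: deShalit1987, Ch. I §3.12 Corollary (proof)] -/
theorem derivative_mem_adicFiltGen {j : ℕ} {t : PowerSeries S} (ht : t ∈ adicFiltGen p j) :
    PowerSeries.derivative S t ∈ adicFiltGen p (j - 1) := by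
  intro k
  rw [PowerSeries.coeff_derivative]
  refine Ideal.mul_mem_right _ _ (Ideal.mem_span_singleton.mpr ?_)
  exact dvd_trans (pow_dvd_pow _ (by omega)) (Ideal.mem_span_singleton.mp (ht (k + 1)))

/-- If the coefficients of `B` up to degree `k` lie in `J`, so does `coeff_k (A · B)`. [cite: deShalit1987, Ch. I §3.12 Corollary (proof)] -/
theorem coeff_mul_mem_of_forall_le {J : Ideal S} {B : PowerSeries S} {k : ℕ} (hB : ∀ j ≤ k, PowerSeries.coeff j B ∈ J)
    (A : PowerSeries S) : PowerSeries.coeff k (A * B) ∈ J := by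
  rw [PowerSeries.coeff_mul]
  refine Ideal.sum_mem _ fun x hx => ?_
  have hx' := Finset.mem_antidiagonal.mp hx
  exact Ideal.mul_mem_left _ _ (hB x.2 (by omega))

/-- `X · U ∈ I_M ⟹ U ∈ I_{M−1}`. [cite: deShalit1987, Ch. I §3.13 Lemma (proof)] -/
theorem mem_adicFiltGen_of_X_mul_mem {M : ℕ} {U : PowerSeries S} (h : PowerSeries.X * U ∈ adicFiltGen p M) :
    U ∈ adicFiltGen p (M - 1) := fun k => by
  have := h (k + 1)
  rwa [PowerSeries.coeff_succ_X_mul, show M - (k + 1) = M - 1 - k by omega] at this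

/-- Cancellation of `p` in a domain: `p · x ∈ (p^m) ⟹ x ∈ (p^{m−1})`. [cite: deShalit1987, Ch. I §3.13 Lemma (proof)] -/
theorem mem_span_pow_pred_of_mul_mem [IsDomain S] (hp : p ≠ 0) {m : ℕ} {x : S} (h : p * x ∈ Ideal.span {p ^ m}) :
    x ∈ Ideal.span {p ^ (m - 1)} := by
  rcases m with _ | m
  · rw [Nat.zero_sub, pow_zero, Ideal.span_singleton_one]; exact Submodule.mem_top
  · obtain ⟨c, hc⟩ := Ideal.mem_span_singleton.mp h
    rw [Nat.add_sub_cancel, Ideal.mem_span_singleton]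
    refine ⟨c, mul_left_cancel₀ hp ?_⟩
    rw [hc, pow_succ]; ring

/-- `(C p + X) · U ∈ I_M ⟹ U ∈ I_{M−1}` over a domain (induction on the coefficient index).
[cite: deShalit1987, Ch. I §3.13 Lemma (proof)] -/
theorem mem_adicFiltGen_of_C_add_X_mul_mem [IsDomain S] (hp : p ≠ 0) {M : ℕ} {U : PowerSeries S}
    (h : (PowerSeries.C p + PowerSeries.X) * U ∈ adicFiltGen p M) : U ∈ adicFiltGen p (M - 1) := by
  have hcoef : ∀ k, PowerSeries.coeff k ((PowerSeries.C p + PowerSeries.X) * U) =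
      p * PowerSeries.coeff k U + (if k = 0 then 0 else PowerSeries.coeff (k - 1) U) := by
    intro k
    rw [add_mul, map_add, PowerSeries.coeff_C_mul]
    rcases k with _ | k
    · rw [PowerSeries.coeff_zero_X_mul, if_pos rfl]
    · rw [PowerSeries.coeff_succ_X_mul, if_neg (Nat.succ_ne_zero k), Nat.add_sub_cancel]
  intro k
  induction k with
  | zero =>
    have h0 := h 0
    rw [hcoef, if_pos rfl, add_zero, Nat.sub_zero] at h0
    simpa using mem_span_pow_pred_of_mul_mem hp h0
  | succ k ih =>
    have h1 := h (k + 1)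
    rw [hcoef, if_neg (Nat.succ_ne_zero k), Nat.add_sub_cancel] at h1
    have h2 : p * PowerSeries.coeff (k + 1) U ∈ Ideal.span {p ^ (M - (k + 1))} := by
      have e : p * PowerSeries.coeff (k + 1) U =
          (p * PowerSeries.coeff (k + 1) U + PowerSeries.coeff k U) - PowerSeries.coeff k U := by ring
      rw [e]
      refine sub_mem h1 (Ideal.mem_span_singleton.mpr (dvd_trans (pow_dvd_pow _ (by omega)) (Ideal.mem_span_singleton.mp ih)))
    have := mem_span_pow_pred_of_mul_mem hp h2
    rwa [show M - (k + 1) - 1 = M - 1 - (k + 1) by omega] at this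

/-- ★ **Cancellation along `∘ f`** for `f = pX + X²` over a domain: **`D ∘ f ∈ I_M ⟹ coeff_k D ∈ (p^{M−2k})`** for all `k`
(`D = D(0) + X·D'`, `D ∘ f = D(0) + X(p + X)·(D' ∘ f)`, induction). [cite: deShalit1987, Ch. I §3.13 Lemma (proof)] -/
theorem coeff_mem_of_subst_mem_adicFiltGen [IsDomain S] (hp : p ≠ 0) :
    ∀ (k : ℕ) {M : ℕ} {D : PowerSeries S},
      PowerSeries.subst (PowerSeries.C p * PowerSeries.X + PowerSeries.X ^ 2) D ∈ adicFiltGen p M →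
        PowerSeries.coeff k D ∈ Ideal.span {p ^ (M - 2 * k)} := by
  have hf0 : PowerSeries.constantCoeff (PowerSeries.C p * PowerSeries.X + PowerSeries.X ^ 2 : PowerSeries S) = 0 := by
    rw [map_add, map_mul, map_pow, PowerSeries.constantCoeff_C, PowerSeries.constantCoeff_X, mul_zero, zero_pow two_ne_zero,
      add_zero]
  have hs : PowerSeries.HasSubst (PowerSeries.C p * PowerSeries.X + PowerSeries.X ^ 2 : PowerSeries S) :=
    PowerSeries.HasSubst.of_constantCoeff_zero' hf0
  -- `D ∘ f = C D(0) + X (C p + X) · (D' ∘ f)`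
  have hdec : ∀ D : PowerSeries S, PowerSeries.subst (PowerSeries.C p * PowerSeries.X + PowerSeries.X ^ 2) D =
      PowerSeries.C (PowerSeries.constantCoeff D) + PowerSeries.X * ((PowerSeries.C p + PowerSeries.X) *
        PowerSeries.subst (PowerSeries.C p * PowerSeries.X + PowerSeries.X ^ 2)
          (PowerSeries.mk fun i => PowerSeries.coeff (i + 1) D)) := by
    have hC : ∀ c : S, PowerSeries.subst (PowerSeries.C p * PowerSeries.X + PowerSeries.X ^ 2) (PowerSeries.C c) =
        PowerSeries.C c := fun c => by
      rw [PowerSeries.subst_C]; rfl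
    intro D
    conv_lhs => rw [PowerSeries.eq_X_mul_shift_add_const D]
    rw [PowerSeries.subst_add hs, PowerSeries.subst_mul hs, PowerSeries.subst_X hs, hC]
    ring
  intro k
  induction k with
  | zero =>
    intro M D hD
    have h0 := hD 0
    rw [PowerSeries.coeff_zero_eq_constantCoeff, hdec, map_add, map_mul, PowerSeries.constantCoeff_C,
      PowerSeries.constantCoeff_X, zero_mul, add_zero] at h0
    rwa [mul_zero, PowerSeries.coeff_zero_eq_constantCoeff]
  | succ k ih =>
    intro M D hD
    have h1 : PowerSeries.X * ((PowerSeries.C p + PowerSeries.X) *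
        PowerSeries.subst (PowerSeries.C p * PowerSeries.X + PowerSeries.X ^ 2)
          (PowerSeries.mk fun i => PowerSeries.coeff (i + 1) D)) ∈ adicFiltGen p M := by
      have e : PowerSeries.X * ((PowerSeries.C p + PowerSeries.X) *
          PowerSeries.subst (PowerSeries.C p * PowerSeries.X + PowerSeries.X ^ 2)
            (PowerSeries.mk fun i => PowerSeries.coeff (i + 1) D)) =
          PowerSeries.subst (PowerSeries.C p * PowerSeries.X + PowerSeries.X ^ 2) D -
            PowerSeries.C (PowerSeries.constantCoeff D) := by
        rw [hdec D]; ring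
      rw [e]
      refine sub_mem hD (C_mem_adicFiltGen ?_)
      have h0 := hD 0
      rw [PowerSeries.coeff_zero_eq_constantCoeff, hdec, map_add, map_mul, PowerSeries.constantCoeff_C,
        PowerSeries.constantCoeff_X, zero_mul, add_zero, Nat.sub_zero] at h0
      exact h0
    have h2 := mem_adicFiltGen_of_C_add_X_mul_mem hp (mem_adicFiltGen_of_X_mul_mem h1)
    have h3 := ih h2
    rw [PowerSeries.coeff_mk] at h3
    rwa [show M - 1 - 1 - 2 * k = M - 2 * (k + 1) by omega] at h3

end AdicFiltGenLemmas

end LubinTate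

section RelativeNormClosed

open GaloisRepresentations.IsNonarchimedeanLocalField LubinTate ValuativeRel

variable (F : Type*) [Field F] [ValuativeRel F] [TopologicalSpace F] [IsNonarchimedeanLocalField F]

attribute [local instance] ltNormUniformSpace ltNormIsUniformAddGroup rk1 nF nE fintypeResidueField

variable {F}
variable {π : 𝒪[F]} (hπ : (valuation F).IsUniformizer (π : F))
variable (E : IntermediateField F (AlgebraicClosure F)) [FiniteDimensional F E]

/-- ★ **The reflection `τ_E : G ↦ G(−π − X)` preserves every `I_N`** (`τ_E X = −X − π ∈ I_1`, `τ_E` fixes constants; induction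
on `N` via `V = V(0) + X·V'`). [cite: deShalit1987, Ch. I §3.12 Corollary (proof)] -/
theorem reflE_mem_adicFiltGen (hq : residueFieldCard F = 2) :
    ∀ (N : ℕ) {V : PowerSeries (unitBall E)}, V ∈ adicFiltGen (algebraMap 𝒪[F] (unitBall E) π) N →
      reflE hπ E V ∈ adicFiltGen (algebraMap 𝒪[F] (unitBall E) π) N := by
  have ht : reflE hπ E PowerSeries.X ∈ adicFiltGen (algebraMap 𝒪[F] (unitBall E) π) 1 := by
    rw [reflE_X hπ E hq]
    exact sub_mem (neg_mem X_mem_adicFiltGen_one) C_self_mem_adicFiltGen_one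
  intro N
  induction N with
  | zero => intro V _; exact mem_adicFiltGen_zero _
  | succ N ih =>
    intro V hV
    have hV0 : PowerSeries.constantCoeff V ∈ Ideal.span {algebraMap 𝒪[F] (unitBall E) π ^ (N + 1)} := by
      have := hV 0; rwa [PowerSeries.coeff_zero_eq_constantCoeff, Nat.sub_zero] at this
    have hV' : (PowerSeries.mk fun i => PowerSeries.coeff (i + 1) V) ∈ adicFiltGen (algebraMap 𝒪[F] (unitBall E) π) N := by
      have := shift_mem_adicFiltGen hV; rwa [Nat.add_sub_cancel] at this
    rw [PowerSeries.eq_X_mul_shift_add_const V, map_add, map_mul, reflE_C]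
    refine add_mem ?_ (C_mem_adicFiltGen hV0)
    have := mul_mem_adicFiltGen ht (ih hV')
    rwa [add_comm] at this

/-- `𝒪_E` has no zero divisors and `π ≠ 0` there. [folklore] -/
private theorem isDomain_unitBall : IsDomain (unitBall E) := inferInstance

/-- ★★ **Twisted-`𝒩_E`-invariant units are closed under `(π, X)`-adic limits** (de Shalit I §3.12 Corollary, relative situation,
algebraic proof): if `ψ(π) = π` and for every `N` there is a unit `G_N` with `𝒩_E G_N = G_N^ψ` and `G − G_N ∈ I_{N+1}`, then
**`𝒩_E G = G^ψ`**.  (With `V = G_N⁻¹G − 1 ∈ I_{N+1}` and `D = 𝒩_E(1+V) − 1`: `D ∘ f = V + τ_E V + V·τ_E V ∈ I_{N+1}`, so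
`coeff_k D ∈ (π^{N+1−2k})`, and `𝒩_E G − G^ψ = G_N^ψ · (D − V^ψ)`.) [cite: deShalit1987, Ch. I §3.12 Corollary] -/
theorem relNormTwo_eq_map_of_forall_sub_mem (hq : residueFieldCard F = 2) {ψ : unitBall E →+* unitBall E}
    (hψ : ψ (algebraMap 𝒪[F] (unitBall E) π) = algebraMap 𝒪[F] (unitBall E) π) (G : PowerSeries (unitBall E))
    (hG : ∀ N : ℕ, ∃ GN : (PowerSeries (unitBall E))ˣ,
      relNormTwo hπ E hq (GN : PowerSeries (unitBall E)) = PowerSeries.map ψ (GN : PowerSeries (unitBall E)) ∧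
        G - GN ∈ adicFiltGen (algebraMap 𝒪[F] (unitBall E) π) (N + 1)) :
    relNormTwo hπ E hq G = PowerSeries.map ψ G := by
  haveI := (isAdicComplete_span_algebraMap_pi hπ E).toIsHausdorff
  haveI := isDomain_unitBall (F := F) E
  set p : unitBall E := algebraMap 𝒪[F] (unitBall E) π with hp
  have hp0 : p ≠ 0 := algebraMap_pi_ne_zero hπ E
  have hfE : (ltSer F π).map (algebraMap (LTCoeff F) (unitBall E)) = PowerSeries.C p * PowerSeries.X + PowerSeries.X ^ 2 := by
    rw [map_ltSer_eq E, hq]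
  rw [← sub_eq_zero]
  refine eq_zero_of_forall_mem_adicFiltGen (p := p) fun M => ?_
  -- work with the `2M`-th approximation
  obtain ⟨GN, hNGN, hGN⟩ := hG (2 * M)
  obtain ⟨V, hV⟩ : ∃ V : PowerSeries (unitBall E), V = ↑(GN⁻¹) * G - 1 := ⟨_, rfl⟩
  have hGV : G = GN * (1 + V) := by
    rw [hV]; linear_combination (-G) * Units.mul_inv GN
  have hVmem : V ∈ adicFiltGen p (2 * M + 1) := by
    have e : V = ↑(GN⁻¹) * (G - GN) := by rw [hV, mul_sub, Units.inv_mul]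
    rw [e]
    exact Ideal.mul_mem_left _ _ hGN
  obtain ⟨D, hD⟩ : ∃ D : PowerSeries (unitBall E), D = relNormTwo hπ E hq (1 + V) - 1 := ⟨_, rfl⟩
  -- `D ∘ f = V + τV + V τV ∈ I_{2M+1}`
  have hs : PowerSeries.HasSubst ((ltSer F π).map (algebraMap (LTCoeff F) (unitBall E))) :=
    PowerSeries.HasSubst.of_constantCoeff_zero' ((isLTSeries_ltSer π).map _).constantCoeff_eq_zero
  have e : PowerSeries.subst ((ltSer F π).map (algebraMap (LTCoeff F) (unitBall E))) D =
      V + reflE hπ E V + V * reflE hπ E V := by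
    rw [hD, PowerSeries.subst_sub hs, subst_relNormTwo, map_add (reflE hπ E), map_one, ← PowerSeries.coe_substAlgHom hs, map_one]
    ring
  have hDf : PowerSeries.subst (PowerSeries.C p * PowerSeries.X + PowerSeries.X ^ 2) D ∈ adicFiltGen p (2 * M + 1) := by
    rw [← hfE, e]
    exact add_mem (add_mem hVmem (reflE_mem_adicFiltGen hπ E hq _ hVmem))
      (adicFiltGen_mono (by omega) (mul_mem_adicFiltGen hVmem (reflE_mem_adicFiltGen hπ E hq _ hVmem)))
  have hDk : ∀ k, PowerSeries.coeff k D ∈ Ideal.span {p ^ (2 * M + 1 - 2 * k)} := fun k =>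
    coeff_mem_of_subst_mem_adicFiltGen hp0 k hDf
  -- `𝒩_E G − G^ψ = G_N^ψ · (D − V^ψ)`
  have hN1V : relNormTwo hπ E hq (1 + V) = 1 + D := by rw [hD]; ring
  have e2 : relNormTwo hπ E hq G - PowerSeries.map ψ G =
      PowerSeries.map ψ (GN : PowerSeries (unitBall E)) * (D - PowerSeries.map ψ V) := by
    rw [hGV, relNormTwo_mul, hNGN, hN1V, map_mul (PowerSeries.map ψ), map_add (PowerSeries.map ψ), map_one]
    ring
  rw [e2]
  intro k
  refine coeff_mul_mem_of_forall_le (fun j hj => ?_) _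
  rw [map_sub (PowerSeries.coeff j)]
  refine sub_mem ?_ ?_
  · exact Ideal.mem_span_singleton.mpr (dvd_trans (pow_dvd_pow _ (by omega)) (Ideal.mem_span_singleton.mp (hDk j)))
  · exact Ideal.mem_span_singleton.mpr (dvd_trans (pow_dvd_pow _ (by omega))
      (Ideal.mem_span_singleton.mp (map_mem_adicFiltGen hψ hVmem j)))

end RelativeNormClosed

end Literature.NumberTheory.GaloisRepresentations
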